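import Summits.QuantumFields.GaugeBoot.DiagonalRPTorusTubeRings
import Summits.QuantumFields.GaugeBoot.DiagonalRPTorusTubeTerms
import HarnessLib

/-!
# Small back-expansion terms of two transverse squares: the eight covering faces
(gauge-boot, L3 sequel, 7/9)

HONEST FRAMING (cell `pub-gaugeboot`, page 1 of every file): the venture produces certified bounds
on lattice expectations at stated coupling, gauge group, dimension and torus size; NOT a mass gap,
NOT a continuum limit, NOT a string tension; NOT Yang–Mills-summit-bearing (barriers
`FixedCouplingUltralocality`, `PerturbativeInvisibility`). This module is bookkeeping for a
structural NEGATIVE result (`DiagonalRPTorusInnerHalfNegativeHighDim`); it discharges nothing by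
itself.

## Content (torus `(ℤ/L)^d`, `L = 2c`, `c ≥ 2`, `i < j < k < l`, compact metrisable `G`,
continuous `ρ` with a centre element `ρ z₀ = ω • 1`, `ω ≠ 1`)

Let `v = sq k l x` be a transverse square on the top inner layer `δ(x) = c - 1` and `u = sq k l z`
one on the mirror image layer `δ(z) = -(c-1)`, and let `Q ⊆ restPlaqs i j c` with `|Q| ≤ 8` and a
NON-ZERO pair term `T_Q(u, v)` (`DiagonalRPTorusTubeTerms`). Then (**`cover_structure`**) every
edge `a` of `v` is covered by a plaquette `qv a ∈ Q`, which is one of the two ring faces of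
`cover_low`, every edge of `u` by some `qu a ∈ Q`, one of the two faces of `cover_high`; these
eight plaquettes are pairwise distinct and exhaust `Q`. Ingredients: the centre-twist vanishing of
uncovered terms, the layer separation of `u` and `v` (`not_hasLink_sq_high_low`, ...), and the fact
that each covering face contains exactly one edge of its square and none of the other square.

Elementary bookkeeping; no named fact.
-/

open MeasureTheory Finset Function

namespace Summit.QuantumFields.GaugeBoot

open Literature.MathematicalPhysics.QuantumFieldTheory

noncomputable section

namespace DiagRPTube

variable {d L : ℕ}

/-! ## Layers of the relevant points -/

section Points

variable {i j k l : Fin d} (hij : i < j) (hjk : j < k) (hkl : k < l) {c : ℕ} (hc : 2 ≤ c)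
  (hL : L = 2 * c)

include hc hL in
/-- `c - 1 ≠ -(c - 1)` in `ℤ/(2c)` (the two observable layers differ). -/
theorem cast_pred_ne_neg : ((c - 1 : ℕ) : ZMod L) ≠ -((c - 1 : ℕ) : ZMod L) := by
  intro h
  have h2 : ((2 * (c - 1) : ℕ) : ZMod L) = 0 := by push_cast; linear_combination h
  rw [ZMod.natCast_eq_zero_iff] at h2
  exact absurd (Nat.le_of_dvd (by omega) h2) (by omega)

include hc hL in
/-- `c - 1 ≠ c` in `ℤ/(2c)`. -/
theorem cast_pred_ne_c : ((c - 1 : ℕ) : ZMod L) ≠ ((c : ℕ) : ZMod L) := by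
  intro h
  have := congrArg ZMod.val h
  rw [val_cast (by omega), val_cast (by omega)] at this
  omega

include hc hL in
/-- `-(c - 1) ≠ c` in `ℤ/(2c)`. -/
theorem neg_cast_pred_ne_c : -((c - 1 : ℕ) : ZMod L) ≠ ((c : ℕ) : ZMod L) := by
  intro h
  apply cast_pred_ne_c hc hL
  rw [← neg_neg ((c - 1 : ℕ) : ZMod L), h, neg_cast_c hL]

include hij hjk hkl in
/-- The end points of the edges of a transverse square lie on the layer of its base. -/
theorem lay_eEnd (x : Site d L) (a : Fin 4) : lay i j (eEnd k l x a) = lay i j x := by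
  have hki : k ≠ i := (ne_of_lt (hij.trans hjk)).symm
  have hkj : k ≠ j := (ne_of_lt hjk).symm
  have hli : l ≠ i := (ne_of_lt (hij.trans (hjk.trans hkl))).symm
  have hlj : l ≠ j := (ne_of_lt (hjk.trans hkl)).symm
  unfold eEnd
  rcases eDir_eq_or (k := k) (l := l) a with h | h <;> rw [h]
  · rw [lay_shift_of_ne _ hki hkj, lay_eStart hki hkj hli hlj]
  · rw [lay_shift_of_ne _ hli hlj, lay_eStart hki hkj hli hlj]

include hij hjk hkl in
/-- A link of a transverse square lies on the layer of its base. -/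
theorem lay_of_hasLink_sq {y s : Site d L} {n : Fin d} (h : HasLink (sq k l hkl y) (s, n)) :
    lay i j s = lay i j y := by
  have hki : k ≠ i := (ne_of_lt (hij.trans hjk)).symm
  have hkj : k ≠ j := (ne_of_lt hjk).symm
  have hli : l ≠ i := (ne_of_lt (hij.trans (hjk.trans hkl))).symm
  have hlj : l ≠ j := (ne_of_lt (hjk.trans hkl)).symm
  obtain ⟨a, ha⟩ := h
  rw [link_sq] at ha
  rw [← show eStart k l y a = s from congrArg Prod.fst ha, lay_eStart hki hkj hli hlj]

include hij hjk hkl in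
/-- Squares on different layers share no link. -/
theorem not_hasLink_sq_of_lay_ne {x z : Site d L} (hxz : lay i j x ≠ lay i j z) (a : Fin 4) :
    ¬ HasLink (sq k l hkl z) (link (sq k l hkl x) a) := by
  intro h
  rw [link_sq] at h
  have h1 := lay_of_hasLink_sq hij hjk hkl h
  have hki : k ≠ i := (ne_of_lt (hij.trans hjk)).symm
  have hkj : k ≠ j := (ne_of_lt hjk).symm
  have hli : l ≠ i := (ne_of_lt (hij.trans (hjk.trans hkl))).symm
  have hlj : l ≠ j := (ne_of_lt (hjk.trans hkl)).symm
  rw [lay_eStart hki hkj hli hlj] at h1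
  exact hxz h1

include hij hjk hkl in
/-- **A ring face reads only squares on the layers of its two squares**: if `ring m y b`
(`m ∈ {i, j}` through `hmk`, `hml`) contains a link of the square at `w`, then `δ(w)` is the
layer of `y` or of `y + e_m`. -/
theorem lay_eq_of_hasLink_ring_sq {m : Fin d} (hmk : m < k) (hml : m < l) {y w : Site d L}
    {a b : Fin 4} (h : HasLink (ring hmk hml y b) (link (sq k l hkl w) a)) :
    lay i j w = lay i j (y.shift m) ∨ lay i j w = lay i j y := by
  rw [link_sq] at h
  rcases hasLink_ring_transverse hmk hml hkl (eDir_eq_or a) h with h' | h'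
  · left
    have := lay_of_hasLink_sq hij hjk hkl (y := y.shift m) (s := eStart k l w a) (n := eDir k l a)
      ⟨b, h'.symm⟩
    have hki : k ≠ i := (ne_of_lt (hij.trans hjk)).symm
    have hkj : k ≠ j := (ne_of_lt hjk).symm
    have hli : l ≠ i := (ne_of_lt (hij.trans (hjk.trans hkl))).symm
    have hlj : l ≠ j := (ne_of_lt (hjk.trans hkl)).symm
    rwa [lay_eStart hki hkj hli hlj] at this
  · right
    have := lay_of_hasLink_sq hij hjk hkl (y := y) (s := eStart k l w a) (n := eDir k l a)
      ⟨b, h'.symm⟩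
    have hki : k ≠ i := (ne_of_lt (hij.trans hjk)).symm
    have hkj : k ≠ j := (ne_of_lt hjk).symm
    have hli : l ≠ i := (ne_of_lt (hij.trans (hjk.trans hkl))).symm
    have hlj : l ≠ j := (ne_of_lt (hjk.trans hkl)).symm
    rwa [lay_eStart hki hkj hli hlj] at this

end Points

/-! ## The eight covering faces -/

section Structure

variable {N : ℕ} {G : Type*} [Group G] [TopologicalSpace G]
  [IsTopologicalGroup G] [CompactSpace G] [MeasurableSpace G] [BorelSpace G]
  [SecondCountableTopology G] {ρ : G →* Matrix (Fin N) (Fin N) ℂ} {β : ℝ}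
  {i j k l : Fin d} (hij : i < j) (hjk : j < k) (hkl : k < l) {c : ℕ} (hc : 2 ≤ c)
  (hL : L = 2 * c) (hρ : Continuous ρ) {z₀ : G} {ω : ℂ}
  (hz₀ : ρ z₀ = ω • (1 : Matrix (Fin N) (Fin N) ℂ)) (hω : ω ≠ 1)
  {x z : Site d L} (hx : lay i j x = ((c - 1 : ℕ) : ZMod L))
  (hz : lay i j z = -((c - 1 : ℕ) : ZMod L))

include hij hjk hkl hc hL hx hz in
/-- The two observable squares share no link. -/
theorem not_hasLink_high_low (a : Fin 4) : ¬ HasLink (sq k l hkl z) (link (sq k l hkl x) a) :=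
  not_hasLink_sq_of_lay_ne hij hjk hkl (by rw [hx, hz]; exact cast_pred_ne_neg hc hL) a

include hij hjk hkl hc hL hx hz in
/-- The two observable squares share no link. -/
theorem not_hasLink_low_high (a : Fin 4) : ¬ HasLink (sq k l hkl x) (link (sq k l hkl z) a) :=
  not_hasLink_sq_of_lay_ne hij hjk hkl (by rw [hx, hz]; exact (cast_pred_ne_neg hc hL).symm) a

include hij hjk hkl hc hL hρ hz₀ hω hx hz in
/-- **Coverage**: a non-zero term covers every edge of both squares. -/
theorem covers_of_pairT_ne_zero [NeZero L] {Q : Finset (Plaquette d L)}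
    (hT : pairT ρ β Q (sq k l hkl z) (sq k l hkl x) ≠ 0) :
    (∀ a : Fin 4, ∃ q ∈ Q, HasLink q (link (sq k l hkl x) a)) ∧
      (∀ a : Fin 4, ∃ q ∈ Q, HasLink q (link (sq k l hkl z) a)) := by
  have hL3 : 3 ≤ L := by omega
  constructor
  · intro a
    by_contra h
    push Not at h
    exact hT (pairT_eq_zero_of_uncovered_right ρ β hρ hL3 hz₀ hω ⟨a, rfl⟩
      (not_hasLink_high_low hij hjk hkl hc hL hx hz a) h)
  · intro a
    by_contra h
    push Not at h
    exact hT (pairT_eq_zero_of_uncovered_left ρ β hρ hL3 hz₀ hω ⟨a, rfl⟩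
      (not_hasLink_low_high hij hjk hkl hc hL hx hz a) h)

include hij hjk hkl in
/-- **A low covering face contains exactly one edge of the low square.** -/
theorem eq_of_hasLink_vface (hL3 : 3 ≤ L) {q : Plaquette d L} {a b : Fin 4}
    (hq : q = ring (hij.trans hjk) (hij.trans (hjk.trans hkl)) x a ∨ q = ring hjk (hjk.trans hkl) (dn x j) a)
    (h : HasLink q (link (sq k l hkl x) b)) : a = b := by
  rcases hq with rfl | rfl
  · exact eq_of_hasLink_ring_low _ _ hkl hL3 h
  · have h' : HasLink (ring hjk (hjk.trans hkl) (dn x j) a) (link (sq k l hkl ((dn x j).shift j)) b) := by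
      rwa [dn_shift]
    exact eq_of_hasLink_ring_high _ _ hkl hL3 h'

include hij hjk hkl in
/-- **A high covering face contains exactly one edge of the high square.** -/
theorem eq_of_hasLink_uface (hL3 : 3 ≤ L) {q : Plaquette d L} {a b : Fin 4}
    (hq : q = ring (hij.trans hjk) (hij.trans (hjk.trans hkl)) (dn z i) a ∨ q = ring hjk (hjk.trans hkl) z a)
    (h : HasLink q (link (sq k l hkl z) b)) : a = b := by
  rcases hq with rfl | rfl
  · have h' : HasLink (ring (hij.trans hjk) (hij.trans (hjk.trans hkl)) (dn z i) a)
        (link (sq k l hkl ((dn z i).shift i)) b) := by rwa [dn_shift]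
    exact eq_of_hasLink_ring_high _ _ hkl hL3 h'
  · exact eq_of_hasLink_ring_low _ _ hkl hL3 h

include hij hjk hkl hc hL hx hz in
/-- **A low covering face contains no edge of the high square.** -/
theorem not_hasLink_vface_high {q : Plaquette d L} {a : Fin 4}
    (hq : q = ring (hij.trans hjk) (hij.trans (hjk.trans hkl)) x a ∨ q = ring hjk (hjk.trans hkl) (dn x j) a)
    (b : Fin 4) : ¬ HasLink q (link (sq k l hkl z) b) := by
  have hij' : i ≠ j := ne_of_lt hij
  intro h
  rcases hq with rfl | rfl
  · rcases lay_eq_of_hasLink_ring_sq hij hjk hkl _ _ h with h1 | h1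
    · rw [lay_shift_i hij', hx, hz, cast_pred_add_one (L := L) hc] at h1
      exact neg_cast_pred_ne_c hc hL h1
    · rw [hx, hz] at h1
      exact cast_pred_ne_neg hc hL h1.symm
  · rcases lay_eq_of_hasLink_ring_sq hij hjk hkl _ _ h with h1 | h1
    · rw [dn_shift, hx, hz] at h1
      exact cast_pred_ne_neg hc hL h1.symm
    · rw [lay_dn_j hij', hx, hz, cast_pred_add_one (L := L) hc] at h1
      exact neg_cast_pred_ne_c hc hL h1

include hij hjk hkl hc hL hx hz in
/-- **A high covering face contains no edge of the low square.** -/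
theorem not_hasLink_uface_low {q : Plaquette d L} {a : Fin 4}
    (hq : q = ring (hij.trans hjk) (hij.trans (hjk.trans hkl)) (dn z i) a ∨ q = ring hjk (hjk.trans hkl) z a)
    (b : Fin 4) : ¬ HasLink q (link (sq k l hkl x) b) := by
  have hij' : i ≠ j := ne_of_lt hij
  intro h
  rcases hq with rfl | rfl
  · rcases lay_eq_of_hasLink_ring_sq hij hjk hkl _ _ h with h1 | h1
    · rw [dn_shift, hx, hz] at h1
      exact cast_pred_ne_neg hc hL h1
    · rw [lay_dn_i hij', hx, hz, neg_cast_pred_sub_one hc hL] at h1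
      exact cast_pred_ne_c hc hL h1
  · rcases lay_eq_of_hasLink_ring_sq hij hjk hkl _ _ h with h1 | h1
    · rw [lay_shift_j hij', hx, hz, neg_cast_pred_sub_one hc hL] at h1
      exact cast_pred_ne_c hc hL h1
    · rw [hx, hz] at h1
      exact cast_pred_ne_neg hc hL h1

include hij hjk hkl hc hL hρ hz₀ hω hx hz in
/-- ★ **The eight covering faces.** For `Q ⊆ restPlaqs` with `|Q| ≤ 8` and `T_Q(u, v) ≠ 0` there
are covering faces `qv a ∈ Q` of the edges of `v` (each one of the two faces of `cover_low`) and
`qu a ∈ Q` of the edges of `u` (faces of `cover_high`), and every plaquette of `Q` is one of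
these eight. -/
theorem cover_structure [NeZero L] {Q : Finset (Plaquette d L)} (hQ : Q ⊆ restPlaqs i j c)
    (hcard : Q.card ≤ 8) (hT : pairT ρ β Q (sq k l hkl z) (sq k l hkl x) ≠ 0) :
    ∃ qv qu : Fin 4 → Plaquette d L,
      (∀ a, qv a ∈ Q ∧ HasLink (qv a) (link (sq k l hkl x) a) ∧
        (qv a = ring (hij.trans hjk) (hij.trans (hjk.trans hkl)) x a ∨
          qv a = ring hjk (hjk.trans hkl) (dn x j) a)) ∧
      (∀ a, qu a ∈ Q ∧ HasLink (qu a) (link (sq k l hkl z) a) ∧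
        (qu a = ring (hij.trans hjk) (hij.trans (hjk.trans hkl)) (dn z i) a ∨
          qu a = ring hjk (hjk.trans hkl) z a)) ∧
      (∀ q ∈ Q, (∃ a, q = qv a) ∨ (∃ a, q = qu a)) := by
  have hL3 : 3 ≤ L := by omega
  obtain ⟨hcv, hcu⟩ := covers_of_pairT_ne_zero hij hjk hkl hc hL hρ hz₀ hω hx hz hT
  choose qv hqvQ hqvL using hcv
  choose qu hquQ hquL using hcu
  have hvt : ∀ a, qv a = ring (hij.trans hjk) (hij.trans (hjk.trans hkl)) x a ∨
      qv a = ring hjk (hjk.trans hkl) (dn x j) a :=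
    fun a => cover_low hij hjk hkl hc hL hx (hQ (hqvQ a)) (hqvL a)
  have hut : ∀ a, qu a = ring (hij.trans hjk) (hij.trans (hjk.trans hkl)) (dn z i) a ∨
      qu a = ring hjk (hjk.trans hkl) z a :=
    fun a => cover_high hij hjk hkl hc hL hz (hQ (hquQ a)) (hquL a)
  refine ⟨qv, qu, fun a => ⟨hqvQ a, hqvL a, hvt a⟩, fun a => ⟨hquQ a, hquL a, hut a⟩, ?_⟩
  -- the eight faces are pairwise distinct, hence exhaust `Q`
  let f : Fin 4 ⊕ Fin 4 → Plaquette d L := Sum.elim qv qu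
  have hf : Function.Injective f := by
    rintro (a | a) (b | b) h
    · exact congrArg Sum.inl (eq_of_hasLink_vface hij hjk hkl hL3 (hvt a)
        (by rw [show qv a = qv b from h]; exact hqvL b))
    · exact absurd (by rw [← show qv a = qu b from h]; exact hqvL a)
        (not_hasLink_uface_low hij hjk hkl hc hL hx hz (hut b) a)
    · exact absurd (by rw [show qu a = qv b from h]; exact hqvL b)
        (not_hasLink_uface_low hij hjk hkl hc hL hx hz (hut a) b)
    · exact congrArg Sum.inr (eq_of_hasLink_uface hij hjk hkl hL3 (hut a)
        (by rw [show qu a = qu b from h]; exact hquL b))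
  have himg : (univ.image f) = Q := by
    apply eq_of_subset_of_card_le
    · intro q hq
      obtain ⟨s, _, rfl⟩ := mem_image.1 hq
      rcases s with a | a
      · exact hqvQ a
      · exact hquQ a
    · rw [card_image_of_injective _ hf]
      simpa using hcard
  intro q hq
  rw [← himg] at hq
  obtain ⟨s, _, rfl⟩ := mem_image.1 hq
  rcases s with a | a
  · exact Or.inl ⟨a, rfl⟩
  · exact Or.inr ⟨a, rfl⟩

end Structure

end DiagRPTube

end

end Summit.QuantumFields.GaugeBoot
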